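import Mathlib.GroupTheory.FiniteAbelian.Basic
import Mathlib.Data.Nat.Factors
import Summits.ABC.IUTFork.FreeProSigmaUniqueRootsNoGo
import HarnessLib

/-!
# Free pro-`ℓ` groups of finite rank have UNIQUE ROOTS (`IsMulTorsionFree`)

Cell `abc-iut`, L4 lineage of abc-iut-f-052 (row «FREE-PRO-ℓ-UNIQUE-ROOTS», sizing abc-iut-L4-t10): the
`Σ = {ℓ}` complement of `FreeProSigmaUniqueRootsNoGo.lean` (abc-iut-L4-t17, p497997: a free pro-`Σ` group
of rank `≥ 2` is NOT `IsMulTorsionFree` once `Σ` holds TWO primes) and of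
`SemiEllipticDoubleCoverSubgroupsEmptyTwoPrimes.lean` (p501052).  PROOF-ONLY (no definitions, no named
facts): classical profinite group theory in the vocabulary `IsFreeProOn` of [AbsTopI] Lemma 4.5 (i)
(S. Mochizuki, *Topics in Absolute Anabelian Geometry I*, 2012, p. 54) and Mathlib's `IsMulTorsionFree`
("`x ↦ xⁿ` injective for every `n ≠ 0`", UNIQUE EXTRACTION OF ROOTS — the `𝒰`-groups of
Clement–Majewicz–Zyman, *The Theory of Nilpotent Groups* (2017), Def. 5.10; for free pro-`p` groups cf.
the Magnus algebra `ℤ_p⟪X⟫`, Dixon–du Sautoy–Mann–Segal (1999) / Ribes–Zalesskii (2010) §3.3).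
MAIN THEOREM `isMulTorsionFree_of_isFreeProOn_of_prime_eq`: a profinite group free pro-`Σ` of finite rank
(`IsFreeProOn G S gens`, any rank) with EVERY PRIME OF `Σ` EQUAL TO ONE PRIME `ℓ` (e.g. `Σ = {ℓ}`) is
`IsMulTorsionFree`; also on open subgroups, and `mem_semiEllipticDoubleCoverSubgroups_of_isFreeProOn_…`:
such a `J ∩ Δ_C` puts `J` INSIDE the typed RHS of [AbsTopII] Cor. 3.3 (ii) (F-0234) — so "two distinct
primes in `Σ`" in the no-go theorems is SHARP.  ROUTE (elementary; a torsion-free-ABELIAN-quotient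
argument on OPEN subgroups — roots are never "detected" in a finite quotient, where uniqueness fails,
e.g. two reflections of `D₈` square to `1`):
* `eq_of_pow_eq_pow_of_isProSet_of_not_dvd` — exponents PRIME TO `ℓ`: every finite quotient `G/N` is an
  `ℓ`-group, on which `g ↦ gᵐ` is the bijection `powCoprime`; so `xᵐ = yᵐ ⇒ x⁻¹y ∈ N` for all `N`;
* `exists_subgroup_character_separating` — FINITE LEVEL: `a ≠ b` in a finite `ℓ`-group `P` lie in a
  subgroup `H` with a character `χ : H → ℤ/d` (`d > 1` an `ℓ`-power), `χ a ≠ χ b` (induction on `|P|`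
  through a central `z ≠ 1`; abelian case `⟨a, z⟩` by `CommGroup.equiv_prod_multiplicative_zmod_of_finite`);
* `ne_pow_of_ne_of_isFreeProOn` — exponent `ℓ`: for `x ≠ y` take an open normal `N ∌ x⁻¹y`, the finite lemma
  in `G/N`, and the OPEN preimage `U ∋ x, y` of `H` with the continuous character `ψ : U → ℤ/d`; `U` is
  again FREE pro-`Σ` (Schreier, `IsFreeProOn.exists_isFreeProOn_of_isOpen`), so `ψ` LIFTS along
  `ℤ/ℓd ↠ ℤ/d` to `ψ′ : U → ℤ/ℓd` (universal property + `hom_ext`: projectivity, the finite shadow of a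
  lift `U → ℤ_ℓ`); `ψ x ≠ ψ y ⇒ ℓ·ψ′x ≠ ℓ·ψ′y = ψ′(y^ℓ)`, so `x^ℓ ≠ y^ℓ` (control `D₈ = F̂₂/N`, `a ↦ s`,
  `b ↦ sr`: `χ = D₈ → D₈/⟨r⟩`, `ψ′ : F̂₂ → ℤ/4`, `ψ′(a²) = 0 ≠ 2 = ψ′(b²)`);
* main theorem: `n = ℓᵃ·m`, `ℓ ∤ m` — the coprime step, then `a` exponent-`ℓ` steps (rank `0`: `G` is
  trivial, `IsFreeProOn.dense_range_lift`).
READING (numbers, not adjectives): with p497997, the binder `IsMulTorsionFree ↥Δ` at a free pro-`Σ` `Δ`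
of rank `≥ 2` is TRUE iff `Σ` has at most one prime.  HONEST FRAMING: classical, refereed group theory
about OUR typing's binder; nothing here bears on [IUTchIII] Cor. 3.12; typed ≠ proved elsewhere; nothing
here asserts abc proved or refuted.
-/

noncomputable section

open Topology

universe u

namespace Summit.ABC.IUTFork

open Literature.AnabelianGeometry.AbsoluteAnabelian

/-! ### Finite level: separating two elements of a finite `ℓ`-group by a cyclic character -/

section FiniteLevel

variable {ℓ : ℕ} [hℓ : Fact ℓ.Prime]

/-- **Separation by a cyclic character on a subgroup, in a finite `ℓ`-group** (induction on a bound
`k ≥ |P|`): for `a ≠ b` in a finite `ℓ`-group `P` some subgroup `H ∋ a, b` admits a homomorphism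
`χ : H → ℤ/d`, `d > 1` an `ℓ`-power, with `χ a ≠ χ b`.  (Through a central `z ≠ 1`: if `a, b` stay
distinct in `P/⟨z⟩`, induct and pull back; otherwise `b = a zⁱ` and one cyclic coordinate of the ABELIAN
subgroup `⟨a, z⟩` separates `a ≠ b`.) [folklore] -/
theorem exists_subgroup_character_separating (k : ℕ) :
    ∀ (P : Type u) [Group P] [Finite P], Nat.card P ≤ k → IsPGroup ℓ P →
      ∀ a b : P, a ≠ b → ∃ (H : Subgroup P) (d : ℕ) (χ : H →* Multiplicative (ZMod d)),
        1 < d ∧ (∀ q : ℕ, q.Prime → q ∣ d → q = ℓ) ∧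
          ∃ (ha : a ∈ H) (hb : b ∈ H), χ ⟨a, ha⟩ ≠ χ ⟨b, hb⟩ := by
  induction k with
  | zero =>
    intro P _ _ hk _ a b _
    haveI : Nonempty P := ⟨a⟩
    exact absurd hk (not_le.mpr Nat.card_pos)
  | succ k ih =>
    intro P _ _ hk hP a b hab
    classical
    haveI : Nontrivial P := ⟨⟨a, b, hab⟩⟩
    haveI := hP.center_nontrivial
    obtain ⟨⟨z, hzc⟩, hz1⟩ := exists_ne (1 : Subgroup.center P)
    have hzcomm : ∀ g : P, g * z = z * g := Subgroup.mem_center_iff.mp hzc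
    set Z : Subgroup P := Subgroup.zpowers z with hZ
    have hZle : Z ≤ Subgroup.center P := (Subgroup.zpowers_le).mpr hzc
    haveI hZn : Z.Normal := ⟨fun m hm g => by
      have hc : g * m = m * g := Subgroup.mem_center_iff.mp (hZle hm) g
      rwa [hc, mul_inv_cancel_right]⟩
    have hcardZ : 1 < Nat.card Z :=
      (Subgroup.one_lt_card_iff_ne_bot Z).mpr (by
        rw [hZ, Ne, Subgroup.zpowers_eq_bot]; exact fun h => hz1 (Subtype.ext h))
    have hcardQ : Nat.card (P ⧸ Z) ≤ k := by
      have h1 := Subgroup.card_eq_card_quotient_mul_card_subgroup Z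
      have h2 : Nat.card (P ⧸ Z) * 2 ≤ Nat.card (P ⧸ Z) * Nat.card Z :=
        Nat.mul_le_mul_left _ hcardZ
      omega
    by_cases hq : (a : P ⧸ Z) ≠ (b : P ⧸ Z)
    · -- the quotient already separates: induct and pull back
      obtain ⟨H', d, χ', h1d, hdp, ha', hb', hne⟩ := ih (P ⧸ Z) hcardQ (hP.to_quotient Z) _ _ hq
      refine ⟨H'.comap (QuotientGroup.mk' Z), d, χ'.comp ((QuotientGroup.mk' Z).subgroupComap H'),
        h1d, hdp, ha', hb', ?_⟩
      change χ' ((QuotientGroup.mk' Z).subgroupComap H' ⟨a, ha'⟩) ≠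
        χ' ((QuotientGroup.mk' Z).subgroupComap H' ⟨b, hb'⟩)
      exact hne
    · -- `b = a zⁱ`: the abelian subgroup `⟨a, z⟩`
      push Not at hq
      obtain ⟨i, hi⟩ := Subgroup.mem_zpowers_iff.mp (QuotientGroup.eq.mp hq)
      have hb_eq : b = a * z ^ i := by rw [hi, mul_inv_cancel_left]
      set H : Subgroup P := Subgroup.closure {a, z} with hHdef
      have hcomm : ∀ x ∈ ({a, z} : Set P), ∀ y ∈ ({a, z} : Set P), x * y = y * x := by
        intro x hx y hy
        simp only [Set.mem_insert_iff, Set.mem_singleton_iff] at hx hy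
        rcases hx with rfl | rfl <;> rcases hy with rfl | rfl
        · rfl
        · exact hzcomm _
        · exact (hzcomm _).symm
        · rfl
      haveI : IsMulCommutative H := Subgroup.isMulCommutative_closure hcomm
      letI : CommGroup H := { toGroup := inferInstance, mul_comm := mul_comm' }
      have haH : a ∈ H := Subgroup.subset_closure (by simp)
      have hzH : z ∈ H := Subgroup.subset_closure (by simp)
      have hbH : b ∈ H := by rw [hb_eq]; exact H.mul_mem haH (H.zpow_mem hzH i)
      have hAB : (⟨a, haH⟩ : H) ≠ ⟨b, hbH⟩ := fun h => hab (congrArg Subtype.val h)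
      obtain ⟨ι, _, nι, hnι, ⟨e⟩⟩ := CommGroup.equiv_prod_multiplicative_zmod_of_finite H
      have hne : e ⟨a, haH⟩ ≠ e ⟨b, hbH⟩ := fun h => hAB (e.injective h)
      obtain ⟨j, hj⟩ := Function.ne_iff.mp hne
      refine ⟨H, nι j,
        (Pi.evalMonoidHom (fun i => Multiplicative (ZMod (nι i))) j).comp e.toMonoidHom,
        hnι j, ?_, haH, hbH, hj⟩
      intro q hq hqd
      obtain ⟨s, hs⟩ := (IsPGroup.iff_card).mp hP
      have hcardH : Nat.card H = ∏ i, nι i := by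
        rw [Nat.card_congr e.toEquiv, Nat.card_pi]
        exact Finset.prod_congr rfl fun i _ => by
          rw [Nat.card_congr Multiplicative.toAdd, Nat.card_zmod]
      have h1 : nι j ∣ Nat.card H := hcardH ▸ Finset.dvd_prod_of_mem _ (Finset.mem_univ j)
      have h2 : Nat.card H ∣ Nat.card P := Subgroup.card_subgroup_dvd_card H
      have h3 : q ∣ ℓ ^ s := hs ▸ (hqd.trans (h1.trans h2))
      exact (Nat.prime_dvd_prime_iff_eq hq hℓ.out).mp (hq.dvd_of_dvd_pow h3)

end FiniteLevel

/-- In `ℤ/ℓd`: if `ℓ·u = ℓ·v` then `u` and `v` have the same image in `ℤ/d` (stated multiplicatively, for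
characters valued in `Multiplicative (ZMod _)`): `ℓd ∣ ℓ·(u − v).val ⇒ d ∣ (u − v).val`. [folklore] -/
theorem castHom_toMul_eq_of_pow_eq {ℓ d : ℕ} (hℓ : 0 < ℓ) [NeZero d] [NeZero (ℓ * d)]
    {u v : Multiplicative (ZMod (ℓ * d))} (h : u ^ ℓ = v ^ ℓ) :
    (ZMod.castHom (dvd_mul_left d ℓ) (ZMod d)).toAddMonoidHom.toMultiplicative u =
      (ZMod.castHom (dvd_mul_left d ℓ) (ZMod d)).toAddMonoidHom.toMultiplicative v := by
  have h' : ℓ • (Multiplicative.toAdd u) = ℓ • (Multiplicative.toAdd v) := by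
    rw [← toAdd_pow, ← toAdd_pow, h]
  set w : ZMod (ℓ * d) := Multiplicative.toAdd u - Multiplicative.toAdd v with hw
  have hw0 : (ℓ : ZMod (ℓ * d)) * w = 0 := by
    rw [hw, mul_sub, ← nsmul_eq_mul, ← nsmul_eq_mul, h', sub_self]
  have hdvd : d ∣ w.val := by
    have h1 : ((ℓ * w.val : ℕ) : ZMod (ℓ * d)) = 0 := by
      rw [Nat.cast_mul, ZMod.natCast_zmod_val, hw0]
    rw [ZMod.natCast_eq_zero_iff] at h1
    exact Nat.dvd_of_mul_dvd_mul_left hℓ h1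
  have huv : ZMod.castHom (dvd_mul_left d ℓ) (ZMod d) (Multiplicative.toAdd u) =
      ZMod.castHom (dvd_mul_left d ℓ) (ZMod d) (Multiplicative.toAdd v) := by
    rw [← sub_eq_zero, ← map_sub, ← hw, ← ZMod.natCast_zmod_val w, map_natCast,
      ZMod.natCast_eq_zero_iff]
    exact hdvd
  simp only [AddMonoidHom.coe_toMultiplicative, Function.comp_apply, RingHom.toAddMonoidHom_eq_coe,
    AddMonoidHom.coe_coe, huv]

/-- A group homomorphism whose kernel contains an OPEN subgroup is continuous. [folklore] -/
theorem continuous_of_isOpen_le_ker {A B : Type*} [Group A] [TopologicalSpace A]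
    [IsTopologicalGroup A] [Group B] [TopologicalSpace B] [ContinuousMul B] (f : A →* B)
    (V : Subgroup A) (hV : IsOpen (V : Set A)) (hle : V ≤ f.ker) : Continuous f := by
  refine continuous_of_continuousAt_one f ?_
  rw [ContinuousAt, Filter.tendsto_def]
  intro s hs
  refine Filter.mem_of_superset (hV.mem_nhds V.one_mem) fun v hv => ?_
  rw [Set.mem_preimage, (MonoidHom.mem_ker).mp (hle hv), ← map_one f]
  exact mem_of_mem_nhds hs

section Profinite

variable {G : Type u} [Group G] [TopologicalSpace G] [IsTopologicalGroup G] [CompactSpace G]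
  [TotallyDisconnectedSpace G]
variable {S : Set ℕ} {ℓ n : ℕ} {gens : Fin n → G}

/-- In a profinite group an element `g ≠ 1` lies outside some open normal subgroup. [folklore] -/
theorem exists_openNormalSubgroup_not_mem {g : G} (hg : g ≠ 1) :
    ∃ N : OpenNormalSubgroup G, g ∉ (N : Subgroup G) := by
  obtain ⟨N, hN⟩ := ProfiniteGrp.exist_openNormalSubgroup_sub_open_nhds_of_one
    (isOpen_compl_singleton (x := g)) (Set.mem_compl_singleton_iff.mpr hg.symm)
  exact ⟨N, fun h => hN h rfl⟩

omit [TotallyDisconnectedSpace G] in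
/-- In a pro-`Σ` compact group all of whose primes `Σ ∩ Primes ⊆ {ℓ}` equal `ℓ`, every open normal
subgroup has `ℓ`-power index. [cite: MochizukiAbsTopI2012, Def 1.1 (iii) p.10] -/
theorem index_eq_prime_pow_of_isProSet (hP : IsProSet G S) (hS : ∀ q ∈ S, q.Prime → q = ℓ)
    (N : Subgroup G) [hN : N.Normal] (hNo : IsOpen (N : Set G)) : ∃ k : ℕ, N.index = ℓ ^ k := by
  haveI : Finite (G ⧸ N) := Subgroup.quotient_finite_of_isOpen N hNo
  haveI : N.FiniteIndex := Subgroup.finiteIndex_of_finite_quotient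
  exact ⟨_, Nat.eq_prime_pow_of_unique_prime_dvd Subgroup.FiniteIndex.index_ne_zero
    fun hd hdvd => hS _ (hP.prime_dvd_index N hN hNo _ hd hdvd) hd⟩

/-- **Exponents prime to `ℓ` in a pro-`ℓ` group**: if the profinite group `G` is pro-`Σ` with every
prime of `Σ` equal to `ℓ`, and `ℓ ∤ m`, then `xᵐ = yᵐ ⇒ x = y` (in each finite quotient `G/N`, an `ℓ`-group,
`g ↦ gᵐ` is the bijection `powCoprime`). [cite: MochizukiAbsTopI2012, Def 1.1 (iii) p.10] -/
theorem eq_of_pow_eq_pow_of_isProSet_of_not_dvd (hP : IsProSet G S) (hℓ : ℓ.Prime)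
    (hS : ∀ q ∈ S, q.Prime → q = ℓ) {m : ℕ} (hm : ¬ ℓ ∣ m) {x y : G} (h : x ^ m = y ^ m) :
    x = y := by
  by_contra hxy
  obtain ⟨N, hN⟩ := exists_openNormalSubgroup_not_mem (g := x⁻¹ * y) (by rwa [Ne, inv_mul_eq_one])
  haveI : (N : Subgroup G).Normal := N.isNormal'
  have hNo : IsOpen ((N : Subgroup G) : Set G) := N.isOpen'
  obtain ⟨k, hk⟩ := index_eq_prime_pow_of_isProSet hP hS (N : Subgroup G) hNo
  have hcop : (Nat.card (G ⧸ (N : Subgroup G))).Coprime m := by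
    change ((N : Subgroup G).index).Coprime m
    rw [hk]
    exact Nat.Coprime.pow_left k ((Nat.Prime.coprime_iff_not_dvd hℓ).mpr hm)
  apply hN
  rw [← QuotientGroup.eq]
  exact (powCoprime hcop).injective (by
    simp only [powCoprime_apply, ← QuotientGroup.mk_pow, h])

/-- In a pro-`Σ` profinite group with a nontrivial element and every prime of `Σ` equal to `ℓ`, the
prime `ℓ` belongs to `Σ` (some open normal subgroup has index `ℓᵏ > 1`).
[cite: MochizukiAbsTopI2012, Def 1.1 (iii) p.10] -/
theorem mem_of_isProSet_of_ne_one (hP : IsProSet G S) (hℓ : ℓ.Prime) (hS : ∀ q ∈ S, q.Prime → q = ℓ)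
    {g : G} (hg : g ≠ 1) : ℓ ∈ S := by
  obtain ⟨M, hM⟩ := exists_openNormalSubgroup_not_mem hg
  haveI : (M : Subgroup G).Normal := M.isNormal'
  obtain ⟨k, hk⟩ := index_eq_prime_pow_of_isProSet hP hS (M : Subgroup G) M.isOpen'
  have hk0 : k ≠ 0 := by
    rintro rfl
    rw [pow_zero, Subgroup.index_eq_one] at hk
    exact hM (hk ▸ Subgroup.mem_top g)
  have hdvd : ℓ ∣ (M : Subgroup G).index := by rw [hk]; exact dvd_pow_self ℓ hk0
  exact hP.prime_dvd_index _ inferInstance M.isOpen' ℓ hℓ hdvd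

variable [T2Space G]

/-- **Exponent `ℓ` in a free pro-`ℓ` group**: if the profinite group `G` is free pro-`Σ` of rank
`n ≥ 1` (`IsFreeProOn G S gens`) with every prime of `Σ` equal to `ℓ ∈ Σ`, then `x ≠ y ⇒ x^ℓ ≠ y^ℓ`
(open normal `N ∌ x⁻¹y`; finite lemma in `G/N`; the OPEN preimage `U ∋ x, y` of `H` is FREE pro-`Σ` by
Schreier; the continuous character `ψ : U → ℤ/d` LIFTS along `ℤ/ℓd ↠ ℤ/d` by the universal property +
`hom_ext`; `ψ x ≠ ψ y ⇒ ψ′(x^ℓ) ≠ ψ′(y^ℓ)`). [cite: MochizukiAbsTopI2012, Lemma 4.5 (i) p.54] -/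
theorem ne_pow_of_ne_of_isFreeProOn (h : IsFreeProOn G S gens) (hn : 1 ≤ n) (hℓ : ℓ.Prime)
    (hℓS : ℓ ∈ S) (hS : ∀ q ∈ S, q.Prime → q = ℓ) {x y : G} (hxy : x ≠ y) : x ^ ℓ ≠ y ^ ℓ := by
  classical
  haveI : Fact ℓ.Prime := ⟨hℓ⟩
  -- an open normal subgroup separating `x` and `y`; the finite `ℓ`-group `G/N`
  obtain ⟨N, hN⟩ := exists_openNormalSubgroup_not_mem (g := x⁻¹ * y) (by rwa [Ne, inv_mul_eq_one])
  haveI : (N : Subgroup G).Normal := N.isNormal'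
  have hNo : IsOpen ((N : Subgroup G) : Set G) := N.isOpen'
  haveI : Finite (G ⧸ (N : Subgroup G)) := Subgroup.quotient_finite_of_isOpen _ hNo
  obtain ⟨k, hk⟩ := index_eq_prime_pow_of_isProSet h.1 hS (N : Subgroup G) hNo
  have hPgrp : IsPGroup ℓ (G ⧸ (N : Subgroup G)) := IsPGroup.of_card hk
  have hab : (x : G ⧸ (N : Subgroup G)) ≠ (y : G ⧸ (N : Subgroup G)) := by
    rw [Ne, QuotientGroup.eq]; exact hN
  -- finite lemma: `H ≤ G/N`, `χ : H → ℤ/d`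
  obtain ⟨H, d, χ, h1d, hdp, ha, hb, hne⟩ :=
    exists_subgroup_character_separating _ _ le_rfl hPgrp _ _ hab
  haveI : NeZero d := ⟨by omega⟩
  -- the OPEN subgroup `U := π⁻¹ H ∋ x, y` and the character `ψ = χ ∘ π : U → ℤ/d`
  set π : G →* G ⧸ (N : Subgroup G) := QuotientGroup.mk' (N : Subgroup G) with hπ
  set U : Subgroup G := H.comap π with hU
  have hNU : (N : Subgroup G) ≤ U := fun g hg => by
    change π g ∈ H
    rw [show π g = 1 from (QuotientGroup.eq_one_iff g).mpr hg]
    exact H.one_mem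
  have hUo : IsOpen (U : Set G) := Subgroup.isOpen_mono hNU hNo
  have hxU : x ∈ U := ha
  have hyU : y ∈ U := hb
  let ψ : U →* Multiplicative (ZMod d) := χ.comp (π.subgroupComap H)
  have hψne : ψ ⟨x, hxU⟩ ≠ ψ ⟨y, hyU⟩ := hne
  letI : TopologicalSpace (Multiplicative (ZMod d)) := ⊥
  haveI : DiscreteTopology (Multiplicative (ZMod d)) := ⟨rfl⟩
  have hψc : Continuous ψ := by
    refine continuous_of_isOpen_le_ker ψ ((N : Subgroup G).subgroupOf U)
      (hNo.preimage continuous_subtype_val) fun u hu => ?_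
    rw [MonoidHom.mem_ker]
    change χ (π.subgroupComap H u) = 1
    have h1 : π.subgroupComap H u = 1 :=
      Subtype.ext ((QuotientGroup.eq_one_iff (u : G)).mpr (Subgroup.mem_subgroupOf.mp hu))
    rw [h1, map_one]
  obtain ⟨m, gens', hfree, -⟩ := h.exists_isFreeProOn_of_isOpen hn U hUo
  -- the lift along `ℤ/ℓd ↠ ℤ/d`
  haveI : NeZero (ℓ * d) := ⟨Nat.mul_ne_zero hℓ.ne_zero (NeZero.ne d)⟩
  letI : TopologicalSpace (Multiplicative (ZMod (ℓ * d))) := ⊥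
  haveI : DiscreteTopology (Multiplicative (ZMod (ℓ * d))) := ⟨rfl⟩
  let red : Multiplicative (ZMod (ℓ * d)) →* Multiplicative (ZMod d) :=
    (ZMod.castHom (dvd_mul_left d ℓ) (ZMod d)).toAddMonoidHom.toMultiplicative
  have hK : ∀ q : ℕ, q.Prime → q ∣ Nat.card (Multiplicative (ZMod (ℓ * d))) → q ∈ S := by
    intro q hq hqd
    rw [Nat.card_congr Multiplicative.toAdd, Nat.card_zmod] at hqd
    rcases (Nat.Prime.dvd_mul hq).mp hqd with h1 | h2
    · rw [(Nat.prime_dvd_prime_iff_eq hq hℓ).mp h1]; exact hℓS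
    · rw [hdp q hq h2]; exact hℓS
  have hKd : ∀ q : ℕ, q.Prime → q ∣ Nat.card (Multiplicative (ZMod d)) → q ∈ S := by
    intro q hq hqd
    rw [Nat.card_congr Multiplicative.toAdd, Nat.card_zmod] at hqd
    rw [hdp q hq hqd]; exact hℓS
  let f : Fin m → Multiplicative (ZMod (ℓ * d)) := fun i =>
    Multiplicative.ofAdd (((Multiplicative.toAdd (ψ (gens' i))).val : ℕ) : ZMod (ℓ * d))
  have hredf : ∀ i, red (f i) = ψ (gens' i) := by
    intro i
    simp only [red, f, AddMonoidHom.coe_toMultiplicative, Function.comp_apply, toAdd_ofAdd,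
      RingHom.toAddMonoidHom_eq_coe, AddMonoidHom.coe_coe, map_natCast, ZMod.natCast_zmod_val,
      ofAdd_toAdd]
  obtain ⟨φ', ⟨hφ'c, hφ'g⟩, -⟩ := hfree.2 (Multiplicative (ZMod (ℓ * d))) hK f
  have hredc : Continuous (red.comp φ') := (continuous_of_discreteTopology (f := ⇑red)).comp hφ'c
  have heq : red.comp φ' = ψ :=
    hfree.hom_ext hKd hredc hψc fun i => by rw [MonoidHom.comp_apply, hφ'g, hredf]
  intro hpow
  have hpowU : (⟨x, hxU⟩ : U) ^ ℓ = ⟨y, hyU⟩ ^ ℓ := Subtype.ext hpow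
  have h1 := congrArg φ' hpowU
  rw [map_pow, map_pow] at h1
  apply hψne
  rw [← heq, MonoidHom.comp_apply, MonoidHom.comp_apply]
  exact castHom_toMul_eq_of_pow_eq hℓ.pos h1

/-- **Exponent `ℓ`, injective form**: in a free pro-`Σ` group of rank `n ≥ 1` with every prime of `Σ`
equal to `ℓ ∈ Σ`, `x^ℓ = y^ℓ ⇒ x = y`. [cite: MochizukiAbsTopI2012, Lemma 4.5 (i) p.54] -/
theorem eq_of_pow_prime_eq_of_isFreeProOn (h : IsFreeProOn G S gens) (hn : 1 ≤ n) (hℓ : ℓ.Prime)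
    (hℓS : ℓ ∈ S) (hS : ∀ q ∈ S, q.Prime → q = ℓ) {x y : G} (hxy : x ^ ℓ = y ^ ℓ) : x = y :=
  by_contra fun hne => ne_pow_of_ne_of_isFreeProOn h hn hℓ hℓS hS hne hxy

/-- A free pro-`Σ` group of rank `0` is trivial (the generated subgroup — here `{1}` — is dense).
[cite: MochizukiAbsTopI2012, Lemma 4.5 (i) p.54] -/
theorem subsingleton_of_isFreeProOn_rank_zero {gens₀ : Fin 0 → G} (h : IsFreeProOn G S gens₀) :
    Subsingleton G := by
  have hd := h.dense_range_lift
  have hrange : Set.range (FreeGroup.lift gens₀) = {1} := by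
    refine Set.ext fun g => ⟨?_, fun hg => ⟨1, by rw [map_one]; exact hg.symm⟩⟩
    rintro ⟨w, rfl⟩
    rw [Subsingleton.elim w 1, map_one]
    rfl
  rw [hrange, dense_iff_closure_eq, closure_singleton] at hd
  have h1 : ∀ x : G, x = 1 := fun x =>
    Set.mem_singleton_iff.mp (show x ∈ ({1} : Set G) by rw [hd]; exact Set.mem_univ x)
  exact ⟨fun x y => (h1 x).trans (h1 y).symm⟩

/-- **MAIN THEOREM — free pro-`ℓ` groups of finite rank have UNIQUE ROOTS.**  If the profinite group
`G` is free pro-`Σ` of finite rank (`IsFreeProOn G S gens`, [AbsTopI] Lemma 4.5 (i); any rank `n`) and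
every prime of `Σ` equals the prime `ℓ`, then `G` is `IsMulTorsionFree`: `xⁿ = yⁿ ⇒ x = y` for all `n ≥ 1`
(`n = ℓᵃ·m`, `ℓ ∤ m`: the coprime step, then `a` exponent-`ℓ` steps).  Sharp: two primes in `Σ` ⇒ NOT
`IsMulTorsionFree` (`not_isMulTorsionFree_of_isFreeProOn_of_prime_ne`). [cite: MochizukiAbsTopI2012, Lemma 4.5 (i) p.54] -/
theorem isMulTorsionFree_of_isFreeProOn_of_prime_eq (h : IsFreeProOn G S gens) (hℓ : ℓ.Prime)
    (hS : ∀ q ∈ S, q.Prime → q = ℓ) : IsMulTorsionFree G := by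
  classical
  refine ⟨fun e he x y hxy => ?_⟩
  dsimp only at hxy
  by_contra hne
  -- rank `n ≥ 1`, else `G` is trivial
  have hn : 1 ≤ n := by
    by_contra hn0
    obtain rfl : n = 0 := by omega
    haveI := subsingleton_of_isFreeProOn_rank_zero h
    exact hne (Subsingleton.elim x y)
  have hℓS : ℓ ∈ S :=
    mem_of_isProSet_of_ne_one h.1 hℓ hS (g := x⁻¹ * y) (by rwa [Ne, inv_mul_eq_one])
  obtain ⟨a, m, hm, rfl⟩ := Nat.exists_eq_pow_mul_and_not_dvd he ℓ hℓ.one_lt.ne'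
  rw [pow_mul, pow_mul] at hxy
  have h1 : x ^ ℓ ^ a = y ^ ℓ ^ a := eq_of_pow_eq_pow_of_isProSet_of_not_dvd h.1 hℓ hS hm hxy
  have key : ∀ (j : ℕ) (u v : G), u ^ ℓ ^ j = v ^ ℓ ^ j → u = v := by
    intro j
    induction j with
    | zero => intro u v huv; simpa using huv
    | succ j ih =>
      intro u v huv
      rw [pow_succ, pow_mul, pow_mul] at huv
      exact ih u v (eq_of_pow_prime_eq_of_isFreeProOn h hn hℓ hℓS hS huv)
  exact hne (key a x y h1)

/-- **Free pro-`{ℓ}` groups of finite rank have unique roots**: `IsFreeProOn G {ℓ} gens ⇒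
IsMulTorsionFree G`. [cite: MochizukiAbsTopI2012, Lemma 4.5 (i) p.54] -/
theorem isMulTorsionFree_of_isFreeProOn_singleton {gens : Fin n → G} (h : IsFreeProOn G {ℓ} gens)
    (hℓ : ℓ.Prime) : IsMulTorsionFree G :=
  isMulTorsionFree_of_isFreeProOn_of_prime_eq h hℓ fun _ hq _ => Set.mem_singleton_iff.mp hq

/-- **Unique roots on every open subgroup** of a free pro-`Σ` group of rank `≥ 1` all of whose primes
equal `ℓ` (open subgroups are again free pro-`Σ`, Schreier). [cite: MochizukiAbsTopI2012, Lemma 4.5 (i) p.54] -/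
theorem isMulTorsionFree_of_isOpen_of_isFreeProOn_of_prime_eq (h : IsFreeProOn G S gens) (hn : 1 ≤ n)
    (hℓ : ℓ.Prime) (hS : ∀ q ∈ S, q.Prime → q = ℓ) (U : Subgroup G) (hU : IsOpen (U : Set G)) :
    IsMulTorsionFree U := by
  haveI : CompactSpace U := isCompact_iff_compactSpace.mp (U.isClosed_of_isOpen hU).isCompact
  obtain ⟨m, gens', hfree, -⟩ := h.exists_isFreeProOn_of_isOpen hn U hU
  exact isMulTorsionFree_of_isFreeProOn_of_prime_eq hfree hℓ hS

end Profinite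

/-- **Sharpness on the typed object of [AbsTopII] Cor. 3.3 (ii)** (F-0234's right-hand side
`semiEllipticDoubleCoverSubgroups`, typing "`J ∩ Δ_C` is torsion-free" as `IsMulTorsionFree`): an open
`J ⊆ Π_C` of index `2` whose `J ∩ Δ_C` is free pro-`Σ` of finite rank with every prime of `Σ` equal to `ℓ`
BELONGS to the typed right-hand side — the converse shape of
`not_mem_semiEllipticDoubleCoverSubgroups_of_isFreeProOn_of_prime_ne` (two primes in `Σ` ⇒ `J ∉`).
[cite: MochizukiAbsTopII2013, Cor 3.3 (ii) p.68] -/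
theorem mem_semiEllipticDoubleCoverSubgroups_of_isFreeProOn_of_prime_eq (C : FundamentalExtension.{u})
    (J : Subgroup C.arith) (hJ : IsOpen (J : Set C.arith)) (hJ2 : J.index = 2) {S : Set ℕ} {ℓ n : ℕ}
    {gens : Fin n → ↥(J ⊓ C.geom)} (hfree : IsFreeProOn ↥(J ⊓ C.geom) S gens) (hℓ : ℓ.Prime)
    (hS : ∀ q ∈ S, q.Prime → q = ℓ) : J ∈ AbsTopII.semiEllipticDoubleCoverSubgroups C := by
  haveI := compactSpace_inf_geom C J hJ
  exact ⟨hJ, hJ2, isMulTorsionFree_of_isFreeProOn_of_prime_eq hfree hℓ hS⟩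

end Summit.ABC.IUTFork
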